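import Summits.Parity.BatemanHorn.Theorems.AlmostPrimeZerosSystemMomentDeficitMassCount

/-!
# Crux `SystemMomentDeficit` (stmt-Parity-11326): the crux as a SIZE law for the large prime factors

Route `AlmostPrimeZeros`, crux `Summit.Parity.BatemanHorn.Theses.AlmostPrimeZeros.SystemMomentDeficit`
(rank 4).  Combining the two-sided localisation (`Localisation.systemMomentDeficit_iff_covLowerBound`,
crux ⟺ `Cov_x(A, B) ≥ −C` with `B = s_f − A` the capped rough COUNT) with the unconditional mass
theorem (`MassCount.abs_cov_smallCount_roughMass_le`, `|Cov_x(A, M)| ≤ C_f` with `M` the rough von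
Mangoldt MASS in units of `log x`) by linearity of the covariance:

* `systemMomentDeficit_iff_covSizeExcessUpperBound` — `SystemMomentDeficit` ⟺ for every Bateman–Horn
  system there is `C` with `Cov_x(A, 2M − B) ≤ C` for all `x ≥ 2`.

Here `2M − B = Σ_{p > √x, p ∣ fᵢ(n)} (2 log p/log x − 1) + (multiplicity / prime-square corrections)` is
the SIZE EXCESS of the large prime factors over the threshold `√x` (each prime `p > √x` dividing a value
contributes `2u_p − 1 ∈ (0, 2 deg fᵢ − 1]`, `u_p = log p/log x`).  So the crux of rank 4 is exactly the
statement that the values of the system with MORE small prime factors do not carry large prime factors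
of systematically LARGER logarithmic size, beyond `O(1)` in covariance — an upper bound on the
correlation of the small-prime count with the SIZES (not the number, not the mass) of the large primes;
the truth is a negative correlation (more small primes ⇒ larger friable part ⇒ smaller giant), and no
method in the tree or in print controls its sign (crux dossier `Cruxes/SystemMomentDeficit/NOTES.md`,
lead c5 §1).

Notation (docstrings only).  `Y = x + 1`, `E g = Y⁻¹ Σ_{0 ≤ n ≤ x} g(n)`, `Cov(g, h) = E(gh) − E g · E h`,
`PP(z)` = primes `≤ z` ∪ prime squares `≤ z`, `Λ` = von Mangoldt.  Everything is [folklore].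
-/

namespace Summit.Parity.BatemanHorn.Cruxes.SystemMomentDeficit.MassCount

open scoped BigOperators
open Finset Polynomial
open Literature.NumberTheory.Sieve
open Summit.Parity.BatemanHorn.Theses.AlmostPrimeZeros
open Summit.Parity.BatemanHorn.Cruxes.SystemMomentDeficit.Localisation

/-- Linear combination in the second variable of an empirical covariance:
`Cov(a, 2m − b) = 2Cov(a, m) − Cov(a, b)`. [folklore] -/
theorem cov_two_mul_sub (x : ℕ) (a m b : ℕ → ℝ) (Y : ℝ) :
    (∑ n ∈ range (x + 1), a n * (2 * m n - b n)) / Y -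
        (∑ n ∈ range (x + 1), a n) / Y * ((∑ n ∈ range (x + 1), (2 * m n - b n)) / Y) =
      2 * ((∑ n ∈ range (x + 1), a n * m n) / Y - (∑ n ∈ range (x + 1), a n) / Y * ((∑ n ∈ range (x + 1), m n) / Y)) -
        ((∑ n ∈ range (x + 1), a n * b n) / Y - (∑ n ∈ range (x + 1), a n) / Y * ((∑ n ∈ range (x + 1), b n) / Y)) := by
  rw [sum_sub_distrib, sum_congr rfl fun n _ => show a n * (2 * m n - b n) = 2 * (a n * m n) - a n * b n by ring,
    sum_sub_distrib, ← mul_sum, ← mul_sum]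
  ring

/-- **`SystemMomentDeficit` ⟺ the size-excess upper bound for every Bateman–Horn system.**  The crux of
rank 4 holds iff for every Bateman–Horn system `f` there is `C` with `Cov_x(A, 2M − B) ≤ C` for all
`x ≥ 2`, where `A(n) = Σᵢ #{q ∈ PP(⌊√x⌋) : q ∣ fᵢ(n)⁺ ≠ 0}` (small count), `B = s_f − A` (capped count
of the prime(-square) factors beyond `√x`) and `M(n) = (Σᵢ Σ_{d ∣ fᵢ(n)⁺, d ∉ PP(⌊√x⌋)} Λ(d))/log x`
(rough von Mangoldt mass): `2M − B` is the size excess `Σ_{p > √x}(2 log p/log x − 1)` of the large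
prime factors (up to bounded multiplicity corrections), and `Cov(A, 2M − B) = 2Cov(A, M) − Cov(A, B)`
with `Cov(A, M) = O(1)` unconditionally (`abs_cov_smallCount_roughMass_le`). [folklore] -/
theorem systemMomentDeficit_iff_covSizeExcessUpperBound :
    SystemMomentDeficit ↔
    ∀ (k : ℕ) (f : Fin k → ℤ[X]), IsBatemanHornSystem f → ∃ C : ℝ, ∀ x : ℕ, 2 ≤ x →
      (∑ n ∈ Finset.range (x + 1), ((∑ i, #((Nat.primesLE (Nat.sqrt x) ∪ ((Nat.primesLE (Nat.sqrt x)).filter (fun p => p ^ 2 ≤ Nat.sqrt x)).image (fun p => p ^ 2)).filter (fun q => q ∣ ((f i).eval (n : ℤ)).toNat ∧ ((f i).eval (n : ℤ)).toNat ≠ 0)) : ℕ) : ℝ) * (2 * ((∑ i, ∑ d ∈ (((f i).eval (n : ℤ)).toNat.divisors).filter (fun d => d ∉ (Nat.primesLE (Nat.sqrt x) ∪ ((Nat.primesLE (Nat.sqrt x)).filter (fun p => p ^ 2 ≤ Nat.sqrt x)).image (fun p => p ^ 2))), ArithmeticFunction.vonMangoldt d) / Real.log x) - ((((∑ i, (((f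 i).eval (n : ℤ)).toNat.factorization.sum fun _ v => min v 2)) : ℕ) : ℝ) - ((∑ i, #((Nat.primesLE (Nat.sqrt x) ∪ ((Nat.primesLE (Nat.sqrt x)).filter (fun p => p ^ 2 ≤ Nat.sqrt x)).image (fun p => p ^ 2)).filter (fun q => q ∣ ((f i).eval (n : ℤ)).toNat ∧ ((f i).eval (n : ℤ)).toNat ≠ 0)) : ℕ) : ℝ)))) / ((x : ℝ) + 1) -
        (∑ n ∈ Finset.range (x + 1), ((∑ i, #((Nat.primesLE (Nat.sqrt x) ∪ ((Nat.primesLE (Nat.sqrt x)).filter (fun p => p ^ 2 ≤ Nat.sqrt x)).image (fun p => p ^ 2)).filter (fun q => q ∣ ((f i).eval (n : ℤ)).toNat ∧ ((f i).eval (n : ℤ)).toNat ≠ 0)) : ℕ) : ℝ)) / ((x : ℝ) + 1) *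
          ((∑ n ∈ Finset.range (x + 1), (2 * ((∑ i, ∑ d ∈ (((f i).eval (n : ℤ)).toNat.divisors).filter (fun d => d ∉ (Nat.primesLE (Nat.sqrt x) ∪ ((Nat.primesLE (Nat.sqrt x)).filter (fun p => p ^ 2 ≤ Nat.sqrt x)).image (fun p => p ^ 2))), ArithmeticFunction.vonMangoldt d) / Real.log x) - ((((∑ i, (((f i).eval (n : ℤ)).toNat.factorization.sum fun _ v => min v 2)) : ℕ) : ℝ) - ((∑ i, #((Nat.primesLE (Nat.sqrt x) ∪ ((Nat.primesLE (Nat.sqrt x)).filter (fun p => p ^ 2 ≤ Nat.sqrt x)).image (fun p => p ^ 2)).filter (fun q => q ∣ ((f i).eval (n : ℤ)).toNat ∧ ((f i).eval (n : ℤ)).toNat ≠ 0)) : ℕ) : ℝ)))) / ((x : ℝ) + 1)) ≤ C := by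
  rw [systemMomentDeficit_iff_covLowerBound]
  refine forall₃_congr fun k f hf => ?_
  obtain ⟨CM, hCM⟩ := abs_cov_smallCount_roughMass_le k f hf
  constructor
  · rintro ⟨C, hC⟩
    refine ⟨2 * CM + C, fun x hx => ?_⟩
    have e := cov_two_mul_sub x (fun n : ℕ => ((∑ i, #((Nat.primesLE (Nat.sqrt x) ∪ ((Nat.primesLE (Nat.sqrt x)).filter (fun p => p ^ 2 ≤ Nat.sqrt x)).image (fun p => p ^ 2)).filter (fun q => q ∣ ((f i).eval (n : ℤ)).toNat ∧ ((f i).eval (n : ℤ)).toNat ≠ 0)) : ℕ) : ℝ)) (fun n : ℕ => ((∑ i, ∑ d ∈ (((f i).eval (n : ℤ)).toNat.divisors).filter (fun d => d ∉ (Nat.primesLE (Nat.sqrt x) ∪ ((Nat.primesLE (Nat.sqrt x)).filter (fun p => p ^ 2 ≤ Nat.sqrt x)).image (fun p => p ^ 2))), ArithmeticFunction.vonMangoldt d) / Real.log x)) (fun n : ℕ => ((((∑ i, (((f i).eval (n : ℤ)).toNat.factorization.sum fun _ v => min v 2)) : ℕ) : ℝ) - ((∑ i, #((Nat.primesLE (Nat.sqrt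 x) ∪ ((Nat.primesLE (Nat.sqrt x)).filter (fun p => p ^ 2 ≤ Nat.sqrt x)).image (fun p => p ^ 2)).filter (fun q => q ∣ ((f i).eval (n : ℤ)).toNat ∧ ((f i).eval (n : ℤ)).toNat ≠ 0)) : ℕ) : ℝ))) ((x : ℝ) + 1)
    beta_reduce at e
    rw [e]
    have h1 := abs_le.1 (hCM x hx)
    have h2 := hC x hx
    linarith [h1.1, h1.2]
  · rintro ⟨C, hC⟩
    refine ⟨2 * CM + C, fun x hx => ?_⟩
    have e := cov_two_mul_sub x (fun n : ℕ => ((∑ i, #((Nat.primesLE (Nat.sqrt x) ∪ ((Nat.primesLE (Nat.sqrt x)).filter (fun p => p ^ 2 ≤ Nat.sqrt x)).image (fun p => p ^ 2)).filter (fun q => q ∣ ((f i).eval (n : ℤ)).toNat ∧ ((f i).eval (n : ℤ)).toNat ≠ 0)) : ℕ) : ℝ)) (fun n : ℕ => ((∑ i, ∑ d ∈ (((f i).eval (n : ℤ)).toNat.divisors).filter (fun d => d ∉ (Nat.primesLE (Nat.sqrt x) ∪ ((Nat.primesLE (Nat.sqrt x)).filter (fun p => p ^ 2 ≤ Nat.sqrt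 x)).image (fun p => p ^ 2))), ArithmeticFunction.vonMangoldt d) / Real.log x)) (fun n : ℕ => ((((∑ i, (((f i).eval (n : ℤ)).toNat.factorization.sum fun _ v => min v 2)) : ℕ) : ℝ) - ((∑ i, #((Nat.primesLE (Nat.sqrt x) ∪ ((Nat.primesLE (Nat.sqrt x)).filter (fun p => p ^ 2 ≤ Nat.sqrt x)).image (fun p => p ^ 2)).filter (fun q => q ∣ ((f i).eval (n : ℤ)).toNat ∧ ((f i).eval (n : ℤ)).toNat ≠ 0)) : ℕ) : ℝ))) ((x : ℝ) + 1)
    beta_reduce at e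
    have h1 := abs_le.1 (hCM x hx)
    have h2 := hC x hx
    rw [e] at h2
    linarith [h1.1, h1.2]

end Summit.Parity.BatemanHorn.Cruxes.SystemMomentDeficit.MassCount
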